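import Summits.HodgeConjecture.HodgeConjecture.Theorems.Ring2HypothesesDescentMotivatedCorrespondenceLift
import Summits.HodgeConjecture.HodgeConjecture.Theorems.Ring2HypothesesDescentAlgebraicCorrespondencesJannsen
import Summits.HodgeConjecture.HodgeConjecture.Theorems.Ring2AbelianAllStandardAPencilsSquare
import Summits.HodgeConjecture.CorCM.Stage4StrictRoadTransitivity
import Literature.AlgebraicGeometry.HodgeTheory.MotivatedClassesProofs
import HarnessLib

/-!
# Ring 2 hypotheses, descent face — ARAPURA'S LEMMA 4.2, CLAUSES `D` AND `B`, ON THE REAL CARRIERS: hom ≡ num and the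
# Lefschetz standard conjecture DESCEND along domination by powers (`HodgeTheory.IsDominatedByPowers`)

research route conditional on HC_CM; not a corollary; Q11.4-sentence-2 already refuted in dim ≥ 3.
Cell `pub-hodge-ring2` (Hodge ladder STAGE 3), seat `ring2-b05` (binder row b05
`Ring2.Hypotheses.MotivatedImpliesAlgebraicAV`, `Ring2HypothesesDescent.lean` :177), gen 41. `HC_CM`
(`Theses.RankFourFaces.CMAbelianHodge`) does not occur in this file; nothing here proves a case of the Hodge
conjecture; no binder of `BINDER-OWNERS.md` is discharged; row b05 stays OPEN and is not asserted. The standard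
conjectures `D` (hom ≡ num) and `B⋆` (André's `⋆_L`-form) occur only as HYPOTHESES on the powers of the dominating
variety `X` and as CONCLUSIONS on the dominated variety `V`.

D. Arapura, *Motivation for Hodge cycles*, Adv. Math. 207 (2006), Lemma 4.2: «Suppose that `X` and `Y` are smooth
projective varieties such that `Y` is motivated by `X`. If `X` and all its powers satisfies one of the conjectures
(`D`, `B`, `HC`, `GHC`) stated above, then the same conjecture holds for `Y` and all its powers.» Printed proof of
the clause `D`: `[Y]` is a direct summand of `Ξ = ⊕ X^{nᵢ}(jᵢ)`, a numerically trivial algebraic `α` on `Y` lifts to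
`β` on `Ξ` with zero complementary component, `β` is numerically trivial, hence `0` by `D(Ξ)`; clause `B`: «Since the
statements `∀ n D(Xⁿ)` and `∀ n B(Xⁿ)` are equivalent, case `B` follows from the previous one» (Kleiman). The tree
renders «`Y` is motivated by `X`» by `HodgeTheory.IsDominatedByPowers m V d X` (Literature
`DominatedByPowersHodgeConjecture`: every `Hᵏ(V(ℂ); ℂ)` is spanned by the images of ALGEBRAIC correspondences from
the cartesian powers `Xᵉ`, Arapura's Lemma 1.1 in algebraic form); the clause `HC` is the tree's
`CorCM.Stage4.Arapura2006_hodgeClasses_algebraic_of_isDominatedByPowers_holds`, the clause «`A_mot = A`» is gen 40's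
`motivatedClasses_le_algebraicClasses_of_isDominatedByPowers`. THIS FILE proves the clauses `D` and `B` on the real
carriers — WITHOUT a splitting of `H(Ξ)`: the TRANSPOSE argument replaces the direct summand.

* §1 `gysinMap_snd_cupProduct_map_fst_mem_algebraicClasses` — the ADJOINT CLASS `snd_*(γ ∪ fst^* b)` of an algebraic
  correspondence class `γ` on `V ⊗ Y` at an ALGEBRAIC `b ∈ Aʳ(V)_ℂ` is algebraic on `Y` (pull-back, cup product and
  Gysin maps preserve algebraic classes: the tree's `fulton1998_map_mem_algebraicClasses_holds`,
  `Voisin2003_cupProduct_algebraicClasses_holds`, `gysinMap_mem_algebraicClasses_of_isSmoothProjective`); it is the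
  class with `⟨γ_*(y) ∪ b, [V]_ν⟩ = ⟨snd_*(γ ∪ fst^* b) ∪ y, [Y]⟩` (gen 40's `cupPairing_corrClassAction_eq_cupPairing_gysinMap_snd`).
* §2 `cupProduct_corrClassAction_eq_zero_of_forall_algebraic` — under `D(Y)` (left non-degeneracy of the cup pairing on
  `A(Y)_ℂ` in the complementary codimensions): if an algebraic `b` on `V` is cup-orthogonal to `T(A^{p'}(Y)_ℂ)` for an
  algebraic correspondence `T : H^{2p'}(Y) → H^{2p}(V)`, it is cup-orthogonal to the WHOLE range `T(H^{2p'}(Y))` (the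
  adjoint class is algebraic and numerically trivial on `Y`, hence `0`).
* §3 **`nondegenerate_algebraicClasses_of_isDominatedByPowers` — ARAPURA'S CLAUSE `D`**: if `V` is dominated by the
  powers of `X` and hom ≡ num holds on every power `Xᵉ` (left form, all complementary codimensions), then the cup
  pairing `Nᵖ H²ᵖ(V(ℂ)) × N^q H^{2q}(V(ℂ)) → H^{2m}` (`p + q = m`) is non-degenerate on both sides (an algebraic `b`
  orthogonal to `Aᵖ(V)` is orthogonal to every range `T(H(Xᵉ))`, i.e. to `H²ᵖ(V(ℂ))` by domination, hence `0` by
  Poincaré duality).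
* §4 **`standardConjectureBStar_of_isDominatedByPowers` — ARAPURA'S CLAUSE `B`**: `B⋆(X^{k+1}, θ)` for all positive
  powers and all `θ` ⟹ `B⋆(V, θ)` for every `θ ∈ H²(V(ℂ); ℂ)` — `B ⟹ A ⟹ D` on each power (ab-andre's
  `standardConjectureA_of_standardConjectureBStar`, `nondegenerate_algebraicClasses_of_standardConjectureA`; the power
  `X⁰ = Spec ℂ` is handled by Poincaré duality), `D` descends to `V ⊗ V` (§3 with
  `CorCM.Stage4.isDominatedByPowers_tensor`), and `D(V ⊗ V) ⟹ B⋆(V, θ)` (ab-andre's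
  `standardConjectureBStar_of_nondegenerate_tensor_self`, Milne's Cor. 6.2 / Kleiman Thm. 4-1 on the carriers); with
  the powers clause (`…_pow_…`, `CorCM.Stage4.isDominatedByPowers_pow`) and the semisimplicity of the algebra of
  algebraic correspondence operators on each `Hᵃ(V(ℂ))` (gen 38's Jannsen dictionary).

HONEST COLUMN. No definition, no named fact (new or displayed), no sorry; kernel theorems whose hypotheses (`D` / `B⋆`
on the powers of `X`) are NOT asserted — the unconditional instances (Arapura's strict abelian class: varieties dominated
by the powers of an abelian variety, where Lieberman's theorem supplies the hypothesis) are in the companion file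
`Ring2HypothesesDescentStandardBStrictAbelian.lean`. Not claimed: the clause `GHC` (no coniveau filtration on odd
degrees in the tree), Arapura's WEAK motivation, anything categorical. Relevance to row b05: `B⋆`/`D`/semisimplicity
are the currencies of the dictionary of gens 36–38 (parent node ⟺ `B(all)` ⟺ `SS(all)` ⟺ `D(all) ⊗ ℂ`; residue
`X ⟺ SS` on the squares of compact abelian pencil totals); this file shows they all descend along domination, so the
open content of `X` sits in pencil totals NOT dominated by the powers of a variety satisfying `B`.

PRESEARCH: [corpus: `paper:arxiv-math_0501348` Arapura 2006 §4 Thm. 4.1, Lemma 4.2 (clauses `D`, `B`), Cor. 4.3,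
re-opened this session (p. 8 of the held text)] — the printed proof goes through the direct summand and Kleiman's
`∀n D(Xⁿ) ⟺ ∀n B(Xⁿ)`; the splitting-free transpose argument of §2–§3 is the one of gen 40's span lift; corpus hybrid
search «Lefschetz standard conjecture varieties dominated by products of curves abelian variety motivated» (Kerr–Pearlstein
2016, Green–Murre–Voisin 1994, Voisin II: generic) and galaxy `all` «motivated by an abelian variety|dominated by products of
curves|Lefschetz standard conjecture holds for» (0 relevant) — certification on the carriers, no novelty in print claimed.

References (bib keys): Arapura2006 (§1 Lemma 1.1, §4 Thm. 4.1, Lemma 4.2, Cor. 4.3), Kleiman1968AlgebraicCycles (§1.4,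
Cor. 2.5, §3 Prop. 3.8, Cor. 3.9, Thm. 3.11), Kleiman1994StandardConjectures (Thm. 4-1, Cor. 5-?), Jannsen1992 (Thm. 1),
Milne2020LefschetzStandardFiniteFields (§6.1 Cor. 6.2), FultonYoungTableaux1997 (App. B §B.1 (5)–(6)),
VoisinHodgeII2003 (Prop. 9.20–9.21, proof of Thm. 10.17 (10.7)), HatcherAT2002 (§3.3 Thm. 3.26, Prop. 3.38).
-/

noncomputable section

-- every declaration of this problem lives in `Summit.HodgeConjecture.HodgeConjecture.…` (summit = sub-problem)
set_option linter.dupNamespace false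

open CategoryTheory AlgebraicGeometry MonoidalCategory CartesianMonoidalCategory
open Literature.AlgebraicTopology.SingularHomology Literature.Geometry.Kaehler
open Literature.AlgebraicGeometry Literature.AlgebraicGeometry.Motives
  Literature.AlgebraicGeometry.HodgeTheory

namespace Summit.HodgeConjecture.HodgeConjecture.Theorems

variable {m n : ℕ} {V Y : SchemeOver ℂ}

/-! ## §1 The adjoint class of an algebraic correspondence at an algebraic class is algebraic -/

/-- **Cup products of algebraic classes are algebraic, in a prescribed target degree** (`2l + 2k = 2c`): the tree's
theorem `Voisin2003_cupProduct_algebraicClasses_holds` (Voisin II Prop. 9.20 with the diagonal pull-back, Fulton 8.3)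
read in degree `2c`. [cite: VoisinHodgeII2003, §9.2.4 Prop. 9.20] [cite: Fulton1998, §8.3 and Cor. 19.2] -/
theorem cupProduct_mem_algebraicClasses_of_degree_eq (hV : IsSmoothProjective m V) {l k c : ℕ}
    (h : 2 * l + 2 * k = 2 * c) {a : complexBetti V (2 * l)} {b : complexBetti V (2 * k)}
    (ha : a ∈ algebraicClasses V l) (hb : b ∈ algebraicClasses V k) : cupProduct h a b ∈ algebraicClasses V c := by
  obtain rfl : c = l + k := by omega
  exact Voisin2003_cupProduct_algebraicClasses_holds hV ha hb

/-- **The adjoint class of an ALGEBRAIC correspondence class at an ALGEBRAIC class is algebraic**: for `V`, `Y` smooth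
projective of dimensions `m`, `n`, `μ` any orientation of `(V ⊗ Y)(ℂ)`, `γ ∈ Nᵉ H^{2e}((V ⊗ Y)(ℂ))` and
`b ∈ Nʳ H^{2r}(V(ℂ))`, the class `snd_*(γ ∪ fst^* b) ∈ H^{2p''}(Y(ℂ))` is algebraic — `fst^*` preserves algebraic
classes (Fulton Cor. 19.2 (b), the tree's `fulton1998_map_mem_algebraicClasses_holds`), so does `γ ∪ ·` (Voisin II
Prop. 9.20, `Voisin2003_cupProduct_algebraicClasses_holds`) and so does the Gysin map of `snd` for any orientations with
Poincaré duality (Fulton 19.1.2, the tree's `gysinMap_mem_algebraicClasses_of_isSmoothProjective`). This is the class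
computing `⟨γ_*(y) ∪ b, [V]_ν⟩ = ⟨snd_*(γ ∪ fst^* b) ∪ y, [Y]⟩` (gen 40's
`cupPairing_corrClassAction_eq_cupPairing_gysinMap_snd`); its motivated twin is gen 40's
`gysinMap_snd_cupProduct_map_fst_mem_motivatedClasses`. [cite: Fulton1998, §19.1.2 and Cor. 19.2]
[cite: VoisinHodgeII2003, §9.2.4 Prop. 9.20–9.21 and proof of Thm. 10.17 (10.7)] -/
theorem gysinMap_snd_cupProduct_map_fst_mem_algebraicClasses (hV : IsSmoothProjective m V)
    (hY : IsSmoothProjective n Y) (μ : HomologicalOrientation ℂ (ComplexPoints (V ⊗ Y)) (2 * (m + n)))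
    {e r p' p'' : ℕ} (h₁ : 2 * e + 2 * r = 2 * (p'' + m)) (H₁ : 2 * (p'' + m) + 2 * p' = 2 * (m + n))
    (H₂ : 2 * p'' + 2 * p' = 2 * n) {γ : complexBetti (V ⊗ Y) (2 * e)} (hγ : γ ∈ algebraicClasses (V ⊗ Y) e)
    {b : complexBetti V (2 * r)} (hb : b ∈ algebraicClasses V r) :
    gysinMap μ (complexOrientationFamily hY) (AlgPoints.mapContinuous (L := ℂ) (snd V Y)) H₁ H₂
        (cupProduct h₁ γ (complexBetti.map (fst V Y) (2 * r) b)) ∈ algebraicClasses Y p'' := by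
  have hVY : IsSmoothProjective (m + n) (V ⊗ Y) := IsSmoothProjective.tensor_holds hV hY
  have hfst : complexBetti.map (fst V Y) (2 * r) b ∈ algebraicClasses (V ⊗ Y) r :=
    fulton1998_map_mem_algebraicClasses_holds (fst V Y) hV hVY r b hb
  have hcup : cupProduct h₁ γ (complexBetti.map (fst V Y) (2 * r) b) ∈ algebraicClasses (V ⊗ Y) (p'' + m) :=
    cupProduct_mem_algebraicClasses_of_degree_eq hVY h₁ hγ hfst
  exact gysinMap_mem_algebraicClasses_of_isSmoothProjective hVY hY μ (complexOrientationFamily hY)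
    (hasPoincareDuality_complexOrientationFamily hY) (snd V Y) H₁ H₂ (by omega) hcup

/-! ## §2 Under `D(Y)`, orthogonality to `T(A(Y))` propagates to the whole range of `T` -/

/-- **If an algebraic class `b ∈ Nʳ H^{2r}(V(ℂ))` (`p + r = m`) is cup-orthogonal to `T(N^{p'} H^{2p'}(Y(ℂ)))` for an
algebraic correspondence `T : H^{2p'}(Y(ℂ)) → H^{2p}(V(ℂ))`, and hom ≡ num holds on `Y` in codimension `p'' = n - p'`
against codimension `p'` (LEFT non-degeneracy `hDY`), then `T(y₀) ∪ b = 0` for EVERY `y₀ ∈ H^{2p'}(Y(ℂ); ℂ)`.**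
With `T = γ_*`: the adjoint class `s = snd_*(γ ∪ fst^* b) ∈ N^{p''}(Y)` (§1) satisfies `⟨s ∪ y, [Y]⟩ = ⟨T y ∪ b, [V]⟩ = 0`
for all algebraic `y`, hence `s = 0` by `hDY`, hence `⟨T y₀ ∪ b, [V]_ν⟩ = ⟨s ∪ y₀, [Y]⟩ = 0` for all `y₀`, and the
top-line Kronecker pairing is injective for any orientation (gen 40's `eq_zero_of_kroneckerPairing_eq_zero_of_orientation`).
Degrees `p' > n` are trivial (`H^{2p'}(Y(ℂ)) = 0`). The motivated twin (André Prop. 3.3 in place of `hDY`) is gen 40's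
`cupProduct_corrClassAction_eq_zero_of_forall_motivated`. [cite: Arapura2006, §4 proof of Lemma 4.2]
[cite: Kleiman1968AlgebraicCycles, §3 Prop. 3.8] [cite: FultonYoungTableaux1997, Appendix B §B.1 (5)–(6)] -/
theorem cupProduct_corrClassAction_eq_zero_of_forall_algebraic (hV : IsSmoothProjective m V)
    (hY : IsSmoothProjective n Y) {p p' r : ℕ} (hpr : p + r = m)
    (hDY : ∀ (p'' : ℕ) (_ : p'' + p' = n), ∀ s ∈ algebraicClasses Y p'',
      (∀ y ∈ algebraicClasses Y p', cupProduct (show 2 * p'' + 2 * p' = 2 * n by omega) s y = 0) → s = 0)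
    {T : complexBetti Y (2 * p') →ₗ[ℂ] complexBetti V (2 * p)} (hT : IsAlgebraicCorrespondence m n V Y T)
    {b : complexBetti V (2 * r)} (hb : b ∈ algebraicClasses V r)
    (horth : ∀ y ∈ algebraicClasses Y p', cupProduct (show 2 * p + 2 * r = 2 * m by omega) (T y) b = 0)
    (y₀ : complexBetti Y (2 * p')) : cupProduct (show 2 * p + 2 * r = 2 * m by omega) (T y₀) b = 0 := by
  classical
  -- no classes of degree `2p' > 2n`
  by_cases hp'n : n < p'
  · haveI := subsingleton_complexBetti hY (show 2 * n < 2 * p' by omega)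
    rw [Subsingleton.elim y₀ 0, map_zero, map_zero, LinearMap.zero_apply]
  obtain ⟨p'', hp''⟩ : ∃ p'', p' + p'' = n := ⟨n - p', by omega⟩
  obtain ⟨μ, ν, hμ, hν, e, q, hab, hq, γ, hγ, rfl⟩ := hT
  obtain rfl : q = 2 * r := by omega
  -- degrees of the adjoint class
  have h₁ : 2 * e + 2 * r = 2 * (p'' + m) := by omega
  have H₁ : 2 * (p'' + m) + 2 * p' = 2 * (m + n) := by omega
  have H₂ : 2 * p'' + 2 * p' = 2 * n := by omega
  -- the adjoint class is algebraic …
  have hs := gysinMap_snd_cupProduct_map_fst_mem_algebraicClasses hV hY μ h₁ H₁ H₂ hγ hb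
  -- … and cup-orthogonal to `N^{p'}(Y)`, hence zero by `D(Y)`
  have hs0 : gysinMap μ (complexOrientationFamily hY) (AlgPoints.mapContinuous (L := ℂ) (snd V Y)) H₁ H₂
      (cupProduct h₁ γ (complexBetti.map (fst V Y) (2 * r) b)) = 0 := by
    refine hDY p'' (by omega) _ hs fun y hy ↦ ?_
    refine cupProduct_eq_zero_of_cupPairing_eq_zero complexOrientationFamily hY _ ?_
    rw [← cupPairing_corrClassAction_eq_cupPairing_gysinMap_snd hY μ ν hν hab hq h₁ H₁ H₂ γ y b,
      cupPairing_apply, horth y hy, map_zero, LinearMap.zero_apply]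
  -- conclude for an arbitrary `y₀`
  refine eq_zero_of_kroneckerPairing_eq_zero_of_orientation hV ν ?_
  rw [← cupPairing_apply, cupPairing_corrClassAction_eq_cupPairing_gysinMap_snd hY μ ν hν hab hq h₁ H₁ H₂ γ y₀ b,
    hs0, map_zero, LinearMap.zero_apply]

/-! ## §3 Arapura's clause `D`: hom ≡ num descends along domination by powers -/

section Dominated

variable {d : ℕ} {X : SchemeOver ℂ}

/-- **An algebraic class of `V` numerically trivial against `Nᵖ(V)` vanishes, if `V` is dominated by the powers of `X`
and hom ≡ num holds on every power `Xᵉ`** (left form, all complementary codimensions — the power `X⁰ = Spec ℂ` included;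
there it is Poincaré duality of the point, see `left_nondegenerate_algebraicClasses_pow_of_standardConjectureBStar`).
Proof: `H²ᵖ(V(ℂ))` is the span of the ranges of algebraic correspondences `T : Hᵃ(Xᵉ(ℂ)) → H²ᵖ(V(ℂ))` (domination; `a`
is even for degree reasons); `T(N(Xᵉ)) ⊆ Nᵖ(V)` (Voisin II Prop. 9.21, ab-andre's
`map_mem_algebraicClasses_of_isAlgebraicCorrespondence`), so `b` is orthogonal to every `T(N(Xᵉ))`, hence to every range
(§2), hence to `H²ᵖ(V(ℂ))`, hence `b = 0` (Poincaré duality, ab-andre-2's `eq_zero_of_forall_cupProduct_eq_zero'`).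
In print: Arapura 2006 Lemma 4.2, clause `D` (via the direct summand `[V] ⊕ [V'] = ⊕[X^{nᵢ}](jᵢ)`).
[cite: Arapura2006, §4 Lemma 4.2 and §1 Lemma 1.1] [cite: Kleiman1968AlgebraicCycles, §3 Prop. 3.8]
[cite: HatcherAT2002, §3.3 Prop. 3.38] -/
theorem eq_zero_of_forall_cupProduct_algebraic_eq_zero_of_isDominatedByPowers (hV : IsSmoothProjective m V)
    (hX : IsSmoothProjective d X) (hdom : IsDominatedByPowers m V d X)
    (hD : ∀ (e p'' p' : ℕ) (_ : p'' + p' = e * d), ∀ s ∈ algebraicClasses (X.pow e) p'',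
      (∀ y ∈ algebraicClasses (X.pow e) p', cupProduct (show 2 * p'' + 2 * p' = 2 * (e * d) by omega) s y = 0) →
        s = 0)
    {p r : ℕ} (hpr : p + r = m) {b : complexBetti V (2 * r)} (hb : b ∈ algebraicClasses V r)
    (horth : ∀ ξ ∈ algebraicClasses V p, cupProduct (show 2 * p + 2 * r = 2 * m by omega) ξ b = 0) : b = 0 := by
  classical
  refine Ring2.AbelianAll.eq_zero_of_forall_cupProduct_eq_zero' hV (show 2 * p + 2 * r = 2 * m by omega)
    fun c ↦ ?_
  -- `c` lies in the span of the ranges of algebraic correspondences from the powers of `X`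
  have hc : c ∈ Submodule.span ℂ
      {c : complexBetti V (2 * p) |
        ∃ (e a : ℕ) (T : complexBetti (X.pow e) a →ₗ[ℂ] complexBetti V (2 * p)),
          IsAlgebraicCorrespondence m (e * d) V (X.pow e) T ∧ c ∈ LinearMap.range T} := by
    rw [hdom (2 * p)]
    exact Submodule.mem_top
  have hker : c ∈ LinearMap.ker ((cupProduct (show 2 * p + 2 * r = 2 * m by omega)).flip b) := by
    refine (Submodule.span_le.2 ?_) hc
    rintro c' ⟨e, a, T, hT, ⟨y₀, rfl⟩⟩
    -- the source degree is even
    have hpar : ∃ p', a = 2 * p' := by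
      obtain ⟨-, -, -, -, e', -, hab', -⟩ := hT
      exact ⟨a / 2, by omega⟩
    obtain ⟨p', rfl⟩ := hpar
    rw [SetLike.mem_coe, LinearMap.mem_ker, LinearMap.flip_apply]
    exact cupProduct_corrClassAction_eq_zero_of_forall_algebraic hV (hX.pow e) hpr
      (fun p'' hp'' ↦ hD e p'' p' hp'') hT hb
      (fun y hy ↦ horth _
        (Ring2.AbelianAll.map_mem_algebraicClasses_of_isAlgebraicCorrespondence hV (hX.pow e) hT hy)) y₀
  rwa [LinearMap.mem_ker, LinearMap.flip_apply] at hker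

/-- **ARAPURA'S LEMMA 4.2, CLAUSE `D`, on the real carriers.** If `V` (smooth projective, dimension `m`) is dominated
by the powers of `X` (dimension `d`) and hom ≡ num holds on every cartesian power `Xᵉ` (left form, all complementary
codimensions), then for `p + q = m` the cup pairing `Nᵖ H²ᵖ(V(ℂ); ℂ) × N^q H^{2q}(V(ℂ); ℂ) → H^{2m}(V(ℂ); ℂ)` is
non-degenerate on BOTH sides — hom ≡ num on `V` (with `ℂ`-coefficients, F-ref2-83). The right statement is
`eq_zero_of_forall_cupProduct_algebraic_eq_zero_of_isDominatedByPowers`; the left one is the same at `(q, p)` by graded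
commutativity (even degrees). The hypothesis on the powers is NOT asserted.
[cite: Arapura2006, §4 Lemma 4.2 and §1 Lemma 1.1] [cite: Kleiman1968AlgebraicCycles, §3 Prop. 3.8 and Cor. 3.9] -/
theorem nondegenerate_algebraicClasses_of_isDominatedByPowers (hV : IsSmoothProjective m V)
    (hX : IsSmoothProjective d X) (hdom : IsDominatedByPowers m V d X)
    (hD : ∀ (e p'' p' : ℕ) (_ : p'' + p' = e * d), ∀ s ∈ algebraicClasses (X.pow e) p'',
      (∀ y ∈ algebraicClasses (X.pow e) p', cupProduct (show 2 * p'' + 2 * p' = 2 * (e * d) by omega) s y = 0) →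
        s = 0)
    {p q : ℕ} (hpq : p + q = m) :
    (∀ ξ ∈ algebraicClasses V p,
        (∀ b ∈ algebraicClasses V q, cupProduct (show 2 * p + 2 * q = 2 * m by omega) ξ b = 0) → ξ = 0) ∧
      (∀ b ∈ algebraicClasses V q,
        (∀ ξ ∈ algebraicClasses V p, cupProduct (show 2 * p + 2 * q = 2 * m by omega) ξ b = 0) → b = 0) := by
  refine ⟨fun ξ hξ h ↦ ?_,
    fun b hb h ↦ eq_zero_of_forall_cupProduct_algebraic_eq_zero_of_isDominatedByPowers hV hX hdom hD hpq hb h⟩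
  refine eq_zero_of_forall_cupProduct_algebraic_eq_zero_of_isDominatedByPowers hV hX hdom hD
    (show q + p = m by omega) hξ fun b hb ↦ ?_
  rw [cupProduct_gradedComm_holds ℂ (ComplexPoints V) (show 2 * q + 2 * p = 2 * m by omega)
    (show 2 * p + 2 * q = 2 * m by omega) b ξ, h b hb, smul_zero]

/-- **The powers clause of `D`**: under the same hypotheses hom ≡ num holds on every cartesian power `Vʲ` (which is
dominated by the powers of `X` as well, `CorCM.Stage4.isDominatedByPowers_pow`). [cite: Arapura2006, §4 Lemma 4.2] -/
theorem nondegenerate_algebraicClasses_pow_of_isDominatedByPowers (hV : IsSmoothProjective m V)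
    (hX : IsSmoothProjective d X) (hdom : IsDominatedByPowers m V d X)
    (hD : ∀ (e p'' p' : ℕ) (_ : p'' + p' = e * d), ∀ s ∈ algebraicClasses (X.pow e) p'',
      (∀ y ∈ algebraicClasses (X.pow e) p', cupProduct (show 2 * p'' + 2 * p' = 2 * (e * d) by omega) s y = 0) →
        s = 0)
    (j : ℕ) {p q : ℕ} (hpq : p + q = j * m) :
    (∀ ξ ∈ algebraicClasses (V.pow j) p,
        (∀ b ∈ algebraicClasses (V.pow j) q, cupProduct (show 2 * p + 2 * q = 2 * (j * m) by omega) ξ b = 0) →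
          ξ = 0) ∧
      (∀ b ∈ algebraicClasses (V.pow j) q,
        (∀ ξ ∈ algebraicClasses (V.pow j) p, cupProduct (show 2 * p + 2 * q = 2 * (j * m) by omega) ξ b = 0) →
          b = 0) :=
  nondegenerate_algebraicClasses_of_isDominatedByPowers (hV.pow j) hX
    (CorCM.Stage4.isDominatedByPowers_pow hX hV hdom j) hD hpq

/-! ## §4 Arapura's clause `B`: the Lefschetz standard conjecture descends along domination by powers -/

/-- **`B⋆` on the positive powers of `X` ⟹ hom ≡ num on ALL powers of `X` (left form).** For `e = k + 1`: `B⋆(Xᵉ, θ)`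
for every `θ` gives Grothendieck's `A(Xᵉ, θ)` for every polarisation class (ab-andre's
`standardConjectureA_of_standardConjectureBStar`), hence `D(Xᵉ)` (Kleiman's `A ⟹ D` over `ℂ`, ab-andre's
`nondegenerate_algebraicClasses_of_standardConjectureA`); for `e = 0` the power is the point `Spec ℂ`, where every class
is algebraic in codimension `0` (`algebraicClasses_zero`) and the statement is Poincaré duality.
[cite: Kleiman1968AlgebraicCycles, §3 Prop. 3.8 and Cor. 3.9] [cite: Grothendieck1968, §3 p. 196 (B(X) ⇒ A(X))] -/
theorem left_nondegenerate_algebraicClasses_pow_of_standardConjectureBStar (hX : IsSmoothProjective d X)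
    (hB : ∀ (k : ℕ) (θ : complexBetti (X.pow (k + 1)) 2), StandardConjectureBStar ((k + 1) * d) (X.pow (k + 1)) θ) :
    ∀ (e p'' p' : ℕ) (_ : p'' + p' = e * d), ∀ s ∈ algebraicClasses (X.pow e) p'',
      (∀ y ∈ algebraicClasses (X.pow e) p', cupProduct (show 2 * p'' + 2 * p' = 2 * (e * d) by omega) s y = 0) →
        s = 0 := by
  intro e
  rcases Nat.eq_zero_or_pos e with rfl | he
  · intro p'' p' hp s _ h
    obtain rfl : p'' = 0 := by omega
    obtain rfl : p' = 0 := by omega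
    refine Ring2.AbelianAll.eq_zero_of_forall_cupProduct_eq_zero (hX.pow 0)
      (show 2 * 0 + 2 * 0 = 2 * (0 * d) by omega) fun y ↦ h y ?_
    rw [algebraicClasses_zero]
    exact Submodule.mem_top
  · obtain ⟨k, rfl⟩ := Nat.exists_eq_succ_of_ne_zero he.ne'
    intro p'' p' hp
    exact (Ring2.AbelianAll.nondegenerate_algebraicClasses_of_standardConjectureA (hX.pow (k + 1))
      (fun θ hθ ↦ Ring2.AbelianAll.standardConjectureA_of_standardConjectureBStar (hX.pow (k + 1)) hθ (hB k θ))
      hp).1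

/-- **`B⋆(V, θ)` from hom ≡ num on the powers of a dominating `X`**: `D` descends to `V ⊗ V` (§3 with
`CorCM.Stage4.isDominatedByPowers_tensor`), and `D(V ⊗ V) ⊗ ℂ ⟹ B⋆(V, θ)` for every `θ ∈ H²(V(ℂ); ℂ)` (ab-andre's
`standardConjectureBStar_of_nondegenerate_tensor_self`: `D ⟹ A` on `V ⊗ V` for `θ ⊞ θ`, then Kleiman's
`A(V × V) ⟹ B(V)`; vacuous unless `θ` is a polarisation class). [cite: Kleiman1968AlgebraicCycles, Thm. 2.9 and §3 Thm. 3.11]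
[cite: Milne2020LefschetzStandardFiniteFields, §6.1 Cor. 6.2] [cite: Arapura2006, §4 Lemma 4.2] -/
theorem standardConjectureBStar_of_isDominatedByPowers_of_nondegenerate (hV : IsSmoothProjective m V)
    (hX : IsSmoothProjective d X) (hdom : IsDominatedByPowers m V d X)
    (hD : ∀ (e p'' p' : ℕ) (_ : p'' + p' = e * d), ∀ s ∈ algebraicClasses (X.pow e) p'',
      (∀ y ∈ algebraicClasses (X.pow e) p', cupProduct (show 2 * p'' + 2 * p' = 2 * (e * d) by omega) s y = 0) →
        s = 0)
    (θ : complexBetti V 2) : StandardConjectureBStar m V θ :=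
  Ring2.AbelianAll.standardConjectureBStar_of_nondegenerate_tensor_self hV
    (fun _ _ hpq ↦ nondegenerate_algebraicClasses_of_isDominatedByPowers (IsSmoothProjective.tensor_holds hV hV) hX
      (CorCM.Stage4.isDominatedByPowers_tensor hX hV hV hdom hdom) hD hpq) θ

/-- **ARAPURA'S LEMMA 4.2, CLAUSE `B`, on the real carriers.** If `V` (smooth projective, dimension `m`) is dominated
by the powers of `X` (dimension `d`) through algebraic correspondences, and the Lefschetz standard conjecture in André's
`⋆_L`-form holds for every positive cartesian power `X^{k+1}` and every class `θ` (`StandardConjectureBStar`, vacuous for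
non-polarisation classes), then `B⋆(V, θ)` holds for every `θ ∈ H²(V(ℂ); ℂ)`. Printed proof: «Since the statements
`∀ n D(Xⁿ)` and `∀ n B(Xⁿ)` are equivalent, case `B` follows from the previous one»; here: `B ⟹ A ⟹ D` on each power,
`D` descends to `V ⊗ V`, `D(V ⊗ V) ⟹ B⋆(V)`. The hypothesis on the powers is NOT asserted.
[cite: Arapura2006, §4 Lemma 4.2 and Thm. 4.1] [cite: Kleiman1994StandardConjectures, Thm. 4-1]
[cite: Kleiman1968AlgebraicCycles, Cor. 2.5, Thm. 2.9 and §3 Cor. 3.9] -/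
theorem standardConjectureBStar_of_isDominatedByPowers (hV : IsSmoothProjective m V) (hX : IsSmoothProjective d X)
    (hdom : IsDominatedByPowers m V d X)
    (hB : ∀ (k : ℕ) (θ : complexBetti (X.pow (k + 1)) 2), StandardConjectureBStar ((k + 1) * d) (X.pow (k + 1)) θ)
    (θ : complexBetti V 2) : StandardConjectureBStar m V θ :=
  standardConjectureBStar_of_isDominatedByPowers_of_nondegenerate hV hX hdom
    (left_nondegenerate_algebraicClasses_pow_of_standardConjectureBStar hX hB) θ

/-- **… and the clause `D` under the printed hypothesis `B`**: `B⋆` on the positive powers of `X` ⟹ hom ≡ num on `V`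
(both sides, all `p + q = m`). [cite: Arapura2006, §4 Lemma 4.2] [cite: Kleiman1968AlgebraicCycles, §3 Cor. 3.9] -/
theorem nondegenerate_algebraicClasses_of_isDominatedByPowers_of_standardConjectureBStar
    (hV : IsSmoothProjective m V) (hX : IsSmoothProjective d X) (hdom : IsDominatedByPowers m V d X)
    (hB : ∀ (k : ℕ) (θ : complexBetti (X.pow (k + 1)) 2), StandardConjectureBStar ((k + 1) * d) (X.pow (k + 1)) θ)
    {p q : ℕ} (hpq : p + q = m) :
    (∀ ξ ∈ algebraicClasses V p,
        (∀ b ∈ algebraicClasses V q, cupProduct (show 2 * p + 2 * q = 2 * m by omega) ξ b = 0) → ξ = 0) ∧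
      (∀ b ∈ algebraicClasses V q,
        (∀ ξ ∈ algebraicClasses V p, cupProduct (show 2 * p + 2 * q = 2 * m by omega) ξ b = 0) → b = 0) :=
  nondegenerate_algebraicClasses_of_isDominatedByPowers hV hX hdom
    (left_nondegenerate_algebraicClasses_pow_of_standardConjectureBStar hX hB) hpq

/-- **The powers clause of `B`** («… then the same conjecture holds for `Y` and all its powers»): `B⋆(Vʲ, θ)` for every
cartesian power `Vʲ` (dimension `j · m`) and every `θ`. [cite: Arapura2006, §4 Lemma 4.2] -/
theorem standardConjectureBStar_pow_of_isDominatedByPowers (hV : IsSmoothProjective m V) (hX : IsSmoothProjective d X)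
    (hdom : IsDominatedByPowers m V d X)
    (hB : ∀ (k : ℕ) (θ : complexBetti (X.pow (k + 1)) 2), StandardConjectureBStar ((k + 1) * d) (X.pow (k + 1)) θ)
    (j : ℕ) (θ : complexBetti (V.pow j) 2) : StandardConjectureBStar (j * m) (V.pow j) θ :=
  standardConjectureBStar_of_isDominatedByPowers (hV.pow j) hX (CorCM.Stage4.isDominatedByPowers_pow hX hV hdom j) hB θ

/-- **Semisimplicity descends too** (Jannsen's theorem on the carriers, gen 37–38): under `B⋆` on the positive powers
of a dominating `X`, the algebra of ALGEBRAIC correspondence operators on each `Hᵃ(V(ℂ); ℂ)` (the `ℂ`-span of the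
actions `[u]_*` of the algebraic classes `u ∈ Nᵐ H^{2m}((V ⊗ V)(ℂ))`, complex orientation family) is a semisimple ring —
`D(V ⊗ V) ⊗ ℂ` (§3 on `V ⊗ V`) and gen 38's `isSemisimpleRing_adjoin_algebraicOperators_of_nondegenerate_tensor_self`.
[cite: Jannsen1992, Thm. 1] [cite: Kleiman1968AlgebraicCycles, §3 Thm. 3.11] [cite: Arapura2006, §4 Thm. 4.1 and Lemma 4.2] -/
theorem isSemisimpleRing_adjoin_algebraicOperators_of_isDominatedByPowers (hV : IsSmoothProjective m V)
    (hX : IsSmoothProjective d X) (hdom : IsDominatedByPowers m V d X)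
    (hB : ∀ (k : ℕ) (θ : complexBetti (X.pow (k + 1)) 2), StandardConjectureBStar ((k + 1) * d) (X.pow (k + 1)) θ)
    (a : ℕ) :
    IsSemisimpleRing (Algebra.adjoin ℂ ((algebraicClasses (V ⊗ V) m).map
      (corrAction complexOrientationFamily hV hV (rfl : a + 2 * m = a + 2 * m)) :
        Set (Module.End ℂ (complexBetti V a)))) :=
  isSemisimpleRing_adjoin_algebraicOperators_of_nondegenerate_tensor_self hV
    (fun _ _ hpq ↦ nondegenerate_algebraicClasses_of_isDominatedByPowers (IsSmoothProjective.tensor_holds hV hV) hX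
      (CorCM.Stage4.isDominatedByPowers_tensor hX hV hV hdom hdom)
      (left_nondegenerate_algebraicClasses_pow_of_standardConjectureBStar hX hB) hpq) a

end Dominated

end Summit.HodgeConjecture.HodgeConjecture.Theorems

end
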